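import Mathlib
import Summits.ValiantsHypothesis.ValiantsHypothesis.Theorems.GrenetZeonPolySizeQPAlgebraTaylorTwo
import Literature.Computability.AlgebraicComplexity.VonZurGathenRegularity
import HarnessLib

/-!
# Crux `GrenetZeon.PolySizeQPAlgebra` (stmt-ValiantsHypothesis-8064), line `vbp-slice-dealg` —
# jets of determinants: the components of `det (B + εX + ηY + εηC)` over `R[η][ε]`, any size

Formal-calculus complement to `…TaylorTwo` for the residual-corank-`q` analysis of the type-independent
local Hessian bound (`…LocalReductionResidualThree`: input `LocalHessianBound₃`, `q ≥ 3`):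

* `map_aeval_jet₂_eq`, `det_jet₂_components` — jets of a NOT necessarily affine polynomial matrix
  (`A(x+[·=s]ε+[·=t]η) = A(x) + ε∂_sA + η∂_tA + εη∂_s∂_tA`) and the four components of its determinant.
* `eval_pderiv_det_eq_trace` — Jacobi at a point: `∂_t det A (x) = tr(adj A(x) · ∂_t A(x))`.
* `eval_pderiv_pderiv_det_eq_sum` — the row expansion
  `∂_s∂_t det A (x) = tr(adj B · ∂_s∂_t A(x)) + Σ_r Σ_{q≠r} det(B | row r ← ∂_t A_r(x), row q ← ∂_s A_q(x))`
  (`VonZurGathen.derivation_det` twice).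
* `det_sqz_jet_components` — **for square `B, X, Y, C` over `R` of any size, the components `1, η, ε, εη`
  of `det (B + εX + ηY + εηC)` over `R[η][ε]` are `det B`, `tr(adj B·Y)`, `tr(adj B·X)`,
  `tr(adj B·C) + Σ_r Σ_{q≠r} det(B | row r ← Y_r, row q ← X_q)`** (realise the jet by the polynomial
  matrix `B + x₀X + x₁Y + x₀x₁C`).

HONEST FRAMING: formal calculus; no stub of the line is closed; VP ≠ VNP is not moved.

References: J. von zur Gathen, J. Symb. Comp. 4 (1987) (derivative of a determinant) [Vonzurgathen1987];
T. Mignon, N. Ressayre, IMRN 2004:79, §2 [MignonRessayre2004].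
-/

noncomputable section

open MvPolynomial Matrix
open Literature.Computability.AlgebraicComplexity

-- single-conjunct layout `Summits/ValiantsHypothesis/ValiantsHypothesis`: duplicated namespace by design
set_option linter.dupNamespace false

namespace Summit.ValiantsHypothesis.ValiantsHypothesis.Theorems.GrenetZeonPolySizeQPAlgebra

/-! ### Jets of a (not necessarily affine) polynomial matrix -/

section Jet

variable {σ : Type*} [DecidableEq σ] {R : Type*} [CommRing R] {ι : Type*} [Fintype ι] [DecidableEq ι]

omit [Fintype ι] [DecidableEq ι] in
/-- The jet substitution on a polynomial matrix: `A(x + [·=s]ε + [·=t]η) = A(x) + ε ∂_s A(x) +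
η ∂_t A(x) + εη ∂_s∂_t A(x)` entrywise in `R[η][ε]`. [folklore] -/
theorem map_aeval_jet₂_eq (x : σ → R) (s t : σ) (A : Matrix ι ι (MvPolynomial σ R)) :
    A.map (aeval fun u => algebraMap R (DualNumber (DualNumber R)) (x u) +
        (if u = s then DualNumber.eps else 0) +
        (if u = t then algebraMap (DualNumber R) (DualNumber (DualNumber R)) DualNumber.eps
          else 0)) =
      (A.map (eval x)).map (algebraMap R (DualNumber (DualNumber R))) +
        (DualNumber.eps : DualNumber (DualNumber R)) •
          (A.map fun a => eval x (pderiv s a)).map (algebraMap R (DualNumber (DualNumber R))) +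
        algebraMap (DualNumber R) (DualNumber (DualNumber R)) DualNumber.eps •
          (A.map fun a => eval x (pderiv t a)).map (algebraMap R (DualNumber (DualNumber R))) +
        ((DualNumber.eps : DualNumber (DualNumber R)) *
            algebraMap (DualNumber R) (DualNumber (DualNumber R)) DualNumber.eps) •
          (A.map fun a => eval x (pderiv s (pderiv t a))).map
            (algebraMap R (DualNumber (DualNumber R))) := by
  ext i j
  · have h := (aeval_jet₂_eq x s t (A i j)).1
    simp only [Matrix.map_apply] at h ⊢
    rw [h]
    simp [Matrix.add_apply, Matrix.smul_apply, algebraMap_jet_components]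
  · have h := (aeval_jet₂_eq x s t (A i j)).2.1
    simp only [Matrix.map_apply] at h ⊢
    rw [h]
    simp [Matrix.add_apply, Matrix.smul_apply, algebraMap_jet_components]
  · have h := (aeval_jet₂_eq x s t (A i j)).2.2.1
    simp only [Matrix.map_apply] at h ⊢
    rw [h]
    simp [Matrix.add_apply, Matrix.smul_apply, algebraMap_jet_components, eta_jet_components]
  · have h := (aeval_jet₂_eq x s t (A i j)).2.2.2
    simp only [Matrix.map_apply] at h ⊢
    rw [h]
    simp [Matrix.add_apply, Matrix.smul_apply, algebraMap_jet_components, eta_jet_components]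

/-- **The four components of a determinant jet**: for ANY polynomial matrix `A`, the components
`1, η, ε, εη` of `det (A(x) + ε ∂_s A(x) + η ∂_t A(x) + εη ∂_s∂_t A(x))` over `R[η][ε]` are
`det A (x)`, `∂_t det A (x)`, `∂_s det A (x)`, `∂_s ∂_t det A (x)`. [folklore] -/
theorem det_jet₂_components (x : σ → R) (s t : σ) (A : Matrix ι ι (MvPolynomial σ R)) :
    (((A.map (eval x)).map (algebraMap R (DualNumber (DualNumber R))) +
        (DualNumber.eps : DualNumber (DualNumber R)) •
          (A.map fun a => eval x (pderiv s a)).map (algebraMap R (DualNumber (DualNumber R))) +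
        algebraMap (DualNumber R) (DualNumber (DualNumber R)) DualNumber.eps •
          (A.map fun a => eval x (pderiv t a)).map (algebraMap R (DualNumber (DualNumber R))) +
        ((DualNumber.eps : DualNumber (DualNumber R)) *
            algebraMap (DualNumber R) (DualNumber (DualNumber R)) DualNumber.eps) •
          (A.map fun a => eval x (pderiv s (pderiv t a))).map
            (algebraMap R (DualNumber (DualNumber R)))).det).fst.fst = eval x A.det ∧
    (((A.map (eval x)).map (algebraMap R (DualNumber (DualNumber R))) +
        (DualNumber.eps : DualNumber (DualNumber R)) •
          (A.map fun a => eval x (pderiv s a)).map (algebraMap R (DualNumber (DualNumber R))) +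
        algebraMap (DualNumber R) (DualNumber (DualNumber R)) DualNumber.eps •
          (A.map fun a => eval x (pderiv t a)).map (algebraMap R (DualNumber (DualNumber R))) +
        ((DualNumber.eps : DualNumber (DualNumber R)) *
            algebraMap (DualNumber R) (DualNumber (DualNumber R)) DualNumber.eps) •
          (A.map fun a => eval x (pderiv s (pderiv t a))).map
            (algebraMap R (DualNumber (DualNumber R)))).det).fst.snd = eval x (pderiv t A.det) ∧
    (((A.map (eval x)).map (algebraMap R (DualNumber (DualNumber R))) +
        (DualNumber.eps : DualNumber (DualNumber R)) •
          (A.map fun a => eval x (pderiv s a)).map (algebraMap R (DualNumber (DualNumber R))) +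
        algebraMap (DualNumber R) (DualNumber (DualNumber R)) DualNumber.eps •
          (A.map fun a => eval x (pderiv t a)).map (algebraMap R (DualNumber (DualNumber R))) +
        ((DualNumber.eps : DualNumber (DualNumber R)) *
            algebraMap (DualNumber R) (DualNumber (DualNumber R)) DualNumber.eps) •
          (A.map fun a => eval x (pderiv s (pderiv t a))).map
            (algebraMap R (DualNumber (DualNumber R)))).det).snd.fst = eval x (pderiv s A.det) ∧
    (((A.map (eval x)).map (algebraMap R (DualNumber (DualNumber R))) +
        (DualNumber.eps : DualNumber (DualNumber R)) •
          (A.map fun a => eval x (pderiv s a)).map (algebraMap R (DualNumber (DualNumber R))) +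
        algebraMap (DualNumber R) (DualNumber (DualNumber R)) DualNumber.eps •
          (A.map fun a => eval x (pderiv t a)).map (algebraMap R (DualNumber (DualNumber R))) +
        ((DualNumber.eps : DualNumber (DualNumber R)) *
            algebraMap (DualNumber R) (DualNumber (DualNumber R)) DualNumber.eps) •
          (A.map fun a => eval x (pderiv s (pderiv t a))).map
            (algebraMap R (DualNumber (DualNumber R)))).det).snd.snd =
      eval x (pderiv s (pderiv t A.det)) := by
  set J : σ → DualNumber (DualNumber R) := fun u =>
    algebraMap R (DualNumber (DualNumber R)) (x u) +
        (if u = s then DualNumber.eps else 0) +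
        (if u = t then algebraMap (DualNumber R) (DualNumber (DualNumber R)) DualNumber.eps
          else 0) with hJ
  have hdet : (A.map (aeval J)).det = aeval J A.det := by
    rw [← AlgHom.coe_toRingHom, ← RingHom.mapMatrix_apply, ← RingHom.map_det]
  rw [← map_aeval_jet₂_eq x s t A, hdet]
  exact aeval_jet₂_eq x s t A.det

end Jet

/-! ### First and second partials of a determinant at a point, by row expansion -/

section RowExpansion

variable {σ : Type*} {R : Type*} [CommRing R] {ι : Type*} [Fintype ι] [DecidableEq ι]

/-- **Jacobi at a point**: `∂_t det A (x) = tr(adj A(x) · ∂_t A(x))`. [folklore] -/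
theorem eval_pderiv_det_eq_trace (x : σ → R) (t : σ) (A : Matrix ι ι (MvPolynomial σ R)) :
    eval x (pderiv t A.det) =
      ((A.map (eval x)).adjugate * A.map fun a => eval x (pderiv t a)).trace := by
  rw [VonZurGathen.derivation_det (pderiv t) A, map_sum, Matrix.trace_mul_comm, Matrix.trace]
  refine Finset.sum_congr rfl fun r _ => ?_
  rw [RingHom.map_det, RingHom.mapMatrix_apply, Matrix.map_updateRow,
    VonZurGathen.det_updateRow_eq_sum_mul_adjugate, Matrix.diag_apply, Matrix.mul_apply]
  rfl

/-- **Second partials of a determinant at a point, by rows**: with `B = A(x)`, `X = ∂_s A(x)`,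
`Y = ∂_t A(x)`, `C = ∂_s∂_t A(x)`,
`∂_s ∂_t det A (x) = tr(adj B · C) + Σ_r Σ_{q ≠ r} det (B with row r ← Y_r, row q ← X_q)`.
[folklore] -/
theorem eval_pderiv_pderiv_det_eq_sum (x : σ → R) (s t : σ) (A : Matrix ι ι (MvPolynomial σ R)) :
    eval x (pderiv s (pderiv t A.det)) =
      ((A.map (eval x)).adjugate * A.map fun a => eval x (pderiv s (pderiv t a))).trace +
        ∑ r, ∑ q, if q = r then 0 else
          (((A.map (eval x)).updateRow r fun c => eval x (pderiv t (A r c))).updateRow q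
            fun c => eval x (pderiv s (A q c))).det := by
  rw [VonZurGathen.derivation_det (pderiv t) A, map_sum, map_sum]
  simp_rw [VonZurGathen.derivation_det (pderiv s)]
  rw [Matrix.trace_mul_comm, Matrix.trace, ← Finset.sum_add_distrib]
  refine Finset.sum_congr rfl fun r _ => ?_
  rw [map_sum]
  have hsplit : ∀ q, eval x (((A.updateRow r fun c => pderiv t (A r c)).updateRow q
      fun c => pderiv s ((A.updateRow r fun c => pderiv t (A r c)) q c)).det) =
      (if q = r then (((A.map (eval x)).updateRow r) fun c => eval x (pderiv s (pderiv t (A r c)))).det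
        else 0) +
      (if q = r then 0 else
          (((A.map (eval x)).updateRow r fun c => eval x (pderiv t (A r c))).updateRow q
            fun c => eval x (pderiv s (A q c))).det) := by
    intro q
    rw [RingHom.map_det, RingHom.mapMatrix_apply, Matrix.map_updateRow, Matrix.map_updateRow]
    by_cases hqr : q = r
    · subst hqr
      rw [if_pos rfl, if_pos rfl, add_zero, Matrix.updateRow_idem]
      congr 2
      funext c
      simp only [Function.comp_apply, Matrix.updateRow_self]
    · rw [if_neg hqr, if_neg hqr, zero_add]
      congr 2
      funext c
      simp only [Function.comp_apply, Matrix.updateRow_ne hqr]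
  simp_rw [hsplit]
  rw [Finset.sum_add_distrib, Finset.sum_ite_eq' Finset.univ r, if_pos (Finset.mem_univ r),
    VonZurGathen.det_updateRow_eq_sum_mul_adjugate, Matrix.diag_apply, Matrix.mul_apply]
  rfl

end RowExpansion

/-! ### The four components of `det (B + εX + ηY + εηC)` over `R[η][ε]` -/

section SqzJet

variable {R : Type*} [CommRing R] {m : Type*} [Fintype m] [DecidableEq m]

/-- **`det (B + εX + ηY + εηC)` over the jet ring**, for square matrices `B, X, Y, C` over `R` of any
size: the components `1, η, ε, εη` are `det B`, `tr(adj B · Y)`, `tr(adj B · X)` and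
`tr(adj B · C) + Σ_r Σ_{q ≠ r} det (B with row r ← Y_r, row q ← X_q)` (realise the jet by the polynomial
matrix `B + x₀ X + x₁ Y + x₀x₁ C` and use `det_jet₂_components`, `eval_pderiv_pderiv_det_eq_sum`).
[folklore] -/
theorem det_sqz_jet_components (B X Y C : Matrix m m R) :
    ((B.map (algebraMap R (DualNumber (DualNumber R))) +
        (DualNumber.eps : DualNumber (DualNumber R)) • X.map (algebraMap R (DualNumber (DualNumber R))) +
        algebraMap (DualNumber R) (DualNumber (DualNumber R)) DualNumber.eps •
          Y.map (algebraMap R (DualNumber (DualNumber R))) +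
        ((DualNumber.eps : DualNumber (DualNumber R)) *
            algebraMap (DualNumber R) (DualNumber (DualNumber R)) DualNumber.eps) •
          C.map (algebraMap R (DualNumber (DualNumber R)))).det).fst.fst = B.det ∧
    ((B.map (algebraMap R (DualNumber (DualNumber R))) +
        (DualNumber.eps : DualNumber (DualNumber R)) • X.map (algebraMap R (DualNumber (DualNumber R))) +
        algebraMap (DualNumber R) (DualNumber (DualNumber R)) DualNumber.eps •
          Y.map (algebraMap R (DualNumber (DualNumber R))) +
        ((DualNumber.eps : DualNumber (DualNumber R)) *
            algebraMap (DualNumber R) (DualNumber (DualNumber R)) DualNumber.eps) •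
          C.map (algebraMap R (DualNumber (DualNumber R)))).det).fst.snd = (B.adjugate * Y).trace ∧
    ((B.map (algebraMap R (DualNumber (DualNumber R))) +
        (DualNumber.eps : DualNumber (DualNumber R)) • X.map (algebraMap R (DualNumber (DualNumber R))) +
        algebraMap (DualNumber R) (DualNumber (DualNumber R)) DualNumber.eps •
          Y.map (algebraMap R (DualNumber (DualNumber R))) +
        ((DualNumber.eps : DualNumber (DualNumber R)) *
            algebraMap (DualNumber R) (DualNumber (DualNumber R)) DualNumber.eps) •
          C.map (algebraMap R (DualNumber (DualNumber R)))).det).snd.fst = (B.adjugate * X).trace ∧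
    ((B.map (algebraMap R (DualNumber (DualNumber R))) +
        (DualNumber.eps : DualNumber (DualNumber R)) • X.map (algebraMap R (DualNumber (DualNumber R))) +
        algebraMap (DualNumber R) (DualNumber (DualNumber R)) DualNumber.eps •
          Y.map (algebraMap R (DualNumber (DualNumber R))) +
        ((DualNumber.eps : DualNumber (DualNumber R)) *
            algebraMap (DualNumber R) (DualNumber (DualNumber R)) DualNumber.eps) •
          C.map (algebraMap R (DualNumber (DualNumber R)))).det).snd.snd =
      (B.adjugate * C).trace +
        ∑ r, ∑ q, if q = r then 0 else ((B.updateRow r (Y r)).updateRow q (X q)).det := by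
  set 𝒜 : Matrix m m (MvPolynomial (Fin 2) R) :=
    B.map MvPolynomial.C + (MvPolynomial.X 0 : MvPolynomial (Fin 2) R) • X.map MvPolynomial.C +
      (MvPolynomial.X 1 : MvPolynomial (Fin 2) R) • Y.map MvPolynomial.C +
      ((MvPolynomial.X 0 : MvPolynomial (Fin 2) R) * MvPolynomial.X 1) • C.map MvPolynomial.C with h𝒜
  have hentry : ∀ i j, 𝒜 i j = MvPolynomial.C (B i j) + MvPolynomial.X 0 * MvPolynomial.C (X i j) +
      MvPolynomial.X 1 * MvPolynomial.C (Y i j) +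
      MvPolynomial.X 0 * MvPolynomial.X 1 * MvPolynomial.C (C i j) := fun i j => by
    simp only [h𝒜, Matrix.add_apply, Matrix.smul_apply, Matrix.map_apply, smul_eq_mul]
  have h10 : ((1 : Fin 2) = 0) = False := by decide
  have h01 : ((0 : Fin 2) = 1) = False := by decide
  have hB : 𝒜.map (eval (0 : Fin 2 → R)) = B := by
    ext i j
    simp [Matrix.map_apply, hentry]
  have hX : (𝒜.map fun a => eval (0 : Fin 2 → R) (pderiv 0 a)) = X := by
    ext i j
    simp [Matrix.map_apply, hentry, Derivation.leibniz, pderiv_X, h10]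
  have hY : (𝒜.map fun a => eval (0 : Fin 2 → R) (pderiv 1 a)) = Y := by
    ext i j
    simp [Matrix.map_apply, hentry, Derivation.leibniz, pderiv_X, h01]
  have hC : (𝒜.map fun a => eval (0 : Fin 2 → R) (pderiv 0 (pderiv 1 a))) = C := by
    ext i j
    simp [Matrix.map_apply, hentry, Derivation.leibniz, pderiv_X, h01]
  have hYrc : ∀ r c, eval (0 : Fin 2 → R) (pderiv 1 (𝒜 r c)) = Y r c := fun r c => by
    rw [← hY]; rfl
  have hXrc : ∀ r c, eval (0 : Fin 2 → R) (pderiv 0 (𝒜 r c)) = X r c := fun r c => by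
    rw [← hX]; rfl
  have key := det_jet₂_components (0 : Fin 2 → R) 0 1 𝒜
  rw [hB, hX, hY, hC] at key
  obtain ⟨k1, k2, k3, k4⟩ := key
  refine ⟨?_, ?_, ?_, ?_⟩
  · rw [k1, RingHom.map_det, RingHom.mapMatrix_apply, hB]
  · rw [k2, eval_pderiv_det_eq_trace, hB, hY]
  · rw [k3, eval_pderiv_det_eq_trace, hB, hX]
  · rw [k4, eval_pderiv_pderiv_det_eq_sum, hB, hC]
    simp only [hYrc, hXrc]

end SqzJet

end Summit.ValiantsHypothesis.ValiantsHypothesis.Theorems.GrenetZeonPolySizeQPAlgebra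

end
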